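import Summits.QuantumFields.YangMills.Theorems.BalabanUVNodesN15PerCubeGreenTwoGridNamedReg335HolderLetters
import Summits.QuantumFields.YangMills.Theorems.BalabanUVNodesN15PerCubeGreenTwoGridKnitDefectReg335Small
import HarnessLib

/-!
# N15 = NE2, road (c) — PROGRAMME (PC), (PC-E-N): n15-c∕373 FOR THE NAMED GREEN's FUNCTIONS — the threshold DISCHARGED by n15-c∕363's `letters_bookkeeping` on top of n15-c∕390;
# `∃ δ w₀ c₀ D`, majorant `D·((L^k)^{−1∕4} + o_B)·e^{−(δ∕16)|y−y′|_T}`, and the `_explicit` edition at `o_B := o_B^{H,expl}`; NO `∃ u′` (dag-n15-c g35, n15-c∕391)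

Cell `pub-ymgap`, seat `pub-ymgap-dag-n15-c` (generation g35; R134 (a) seat, strategy s1 «first missing estimate»; HUMAN RULING D-0062; chair R424 venue).
`bears_on: R4∕N15 · K3⁸ SpineGivenEndpointR13SepCoPHV (stmt-QuantumFields-27366)`; filed `--kind proof --supports stmt-QuantumFields-27366 --as helper` — COUNT-NEUTRAL.
TWO theorems, 0 `def`, 0 `sorry`: `uN_idef_scGreenOp_of_reg335Holder_small` ∕ `…_small_explicit` = n15-c∕373's two theorems VERBATIM with the parent replaced by n15-c∕390, the
conclusions stated for THE named inverses `scGreenOp′ … U′` ∕ `scGreenOp … U` (n15-c∕388), and the `⟨u′, hu′, ·⟩` threading removed.  Imports BY NAME n15-c∕390 and n15-c∕355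
`…KnitDefectReg335Small` (`letters_bookkeeping`); generator HOME `tools/g35/gf_wrap.py`; nothing in the tree is modified.
HONEST FRAMING ∕ LIMITS.  Bookkeeping over landed theorems (real algebra on the majorant only); MODEL two-grid setting (King tori, straight-holonomy pairing, one cube scale `ξ`); the
datum is the typed per-cube class as a HYPOTHESIS; nothing of [B9]∕[B11] asserted.  NE2⁺ NOT PRINTED ∕ NOT proved; N15 of record untouched (DISCHARGED AS CONSUMED, p687738); K3⁸ OPEN;
counts of record UNMOVED (typed 28∕28 · discharged 8∕27); one finite 𝕋⁴ at fixed ε per index — NOT infinite volume, NOT OS on ℝ⁴, NOT a mass gap, NOT Clay.  Restate-immune (no Theses import).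
-/



set_option autoImplicit false

noncomputable section

open scoped BigOperators Matrix Matrix.Norms.L2Operator
open Finset

namespace Summit.QuantumFields.YangMills.BalabanUVNodes.N15.Gluing

open Real
open Literature.MathematicalPhysics.QuantumFieldTheory.Balaban1983to89
open Literature.MathematicalPhysics.QuantumFieldTheory.Balaban1983to89.B5Prop11Plancherel (Tor fine unitVec)
open Literature.MathematicalPhysics.QuantumFieldTheory.Balaban1983to89.B11SectG (BlockNorm HasMaj)
open Literature.MathematicalPhysics.QuantumFieldTheory.Balaban1983to89.T4EtaRateDefect (idef)
open Literature.MathematicalPhysics.QuantumFieldTheory.Balaban1983to89.B6UnitTorusCarrier (unitTorusGeo)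
open Summit.QuantumFields.YangMills.BalabanUVNodes.N15.CurvedSpecies (Reg335HolderCube)
open Literature.MathematicalPhysics.QuantumFieldTheory.King1986 (aK aK_pos aK_le)
open Literature.MathematicalPhysics.QuantumFieldTheory.King1986.Torus (tdistT)
open Literature.MathematicalPhysics.QuantumFieldTheory.Balaban1983to89.B7Prop10InLambdaRec (one_add_pow_sub_one_le)
open Literature.Barriers.QuantumFields (traceForm)
open Summit.QuantumFields.YangMills.BalabanUVNodes.N15.BackgroundLayer (tCoefA tCoefC)
open Summit.QuantumFields.YangMills.BalabanUVNodes.N15.VectorPiece (kingPr)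
open Summit.QuantumFields.YangMills.BalabanUVNodes.N15.MatrixSpecies (coordMat basisConst basisConst_nonneg liftBlk liftMap)
open Summit.QuantumFields.YangMills.BalabanUVNodes.N15.CurvedSpecies (gaugePair)
open Summit.QuantumFields.YangMills.BalabanUVNodes.N15.CovAvg (mprod kingSec ctauS)

variable {d : ℕ}

section Small

variable {L : ℕ} [NeZero L]
set_option maxHeartbeats 3200000 in
/-- ★★★ n15-c∕373 for THE NAMED scalar covariant Green's functions: ONE `Reg335HolderCube` datum per cube + ONE smallness condition ⟹ the two-grid η-defect of
`scGreenOp′ U′` against `scGreenOp U` is `≤ D·((L^k)^{−1∕4} + o_B)·e^{−(δ∕16)|y−y′|_T}` (NO `∃ u′`).  See the module docstring.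
[cite: Balaban1985BackgroundPropagators, (3.24)–(3.25) p.394, (3.35) p.396, (3.51)–(3.52) p.400 (shapes); Balaban1985Variational, Thm 1 (9) p.279 (shape); King1986, p.664 (pairing)] -/
theorem uN_idef_scGreenOp_of_reg335Holder_small (hL : Odd L ∧ 1 < L) (hL7 : 7 ≤ L) {a₀ : ℝ} (ha₀ : 0 < a₀) (ι : Type) [Fintype ι] [DecidableEq ι] :
    ∃ δ w₀ c₀ D : ℝ, 0 < δ ∧ 0 < c₀ ∧ ∀ (mv kk r : ℕ), 1 ≤ kk → 1 ≤ r → w₀ ≤ ((L ^ mv : ℕ) : ℝ) →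
      ∀ {mm : Type} [Fintype mm] [DecidableEq mm] [Nonempty mm] (e : Matrix mm mm ℂ ≃L[ℝ] (ι → ℝ)), (∀ A B : Matrix mm mm ℂ, traceForm A B = e A ⬝ᵥ e B) →
      ∀ (U' : Fin (d + 1) → ScX' d L mv kk r hL → (Matrix mm mm ℂ)ˣ), (∀ μ x', (U' μ x' : Matrix mm mm ℂ) ∈ Matrix.unitaryGroup mm ℂ) →
      ∀ (Q : (Fin (d + 1) → ZMod (2 * L)) → Set (ScX' d L mv kk r hL)) (ξ C β Cβ : ℝ), 0 < ξ → 0 ≤ C → 0 ≤ β → 0 ≤ Cβ →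
        (1 + @basisConst ι _ (Matrix mm mm ℂ) Matrix.frobeniusNormedAddCommGroup Matrix.frobeniusNormedSpace e * (2 * Real.sqrt (Fintype.card mm)) * Real.sqrt (Fintype.card mm)) ^ 2 * (C / ξ + C / ξ ^ 2) ≤ c₀ →
        (∀ k, Reg335HolderCube (scShift' d L mv kk r hL) U' ((((L ^ r * L ^ kk : ℕ) : ℝ))⁻¹) (Q k) ξ (fun z z' => ((((L ^ r * L ^ kk : ℕ) : ℝ))⁻¹) * tdistT (fine (L ^ r * L ^ kk) (cvM d L mv kk hL)) z z') C β Cβ) →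
        (∀ k z, (∃ y ∈ cvSk d L mv kk hL k, (unitTorusGeo L kk (cvM d L mv kk hL)).dist (scBlk' d L mv kk r hL z) y ≤ 5) → z ∈ Q k) →
      ∀ (oB : ℝ), 0 ≤ oB →
        (@basisConst ι _ (Matrix mm mm ℂ) Matrix.frobeniusNormedAddCommGroup Matrix.frobeniusNormedSpace e * (((L ^ r * L ^ kk : ℕ) : ℝ) ^ 2 * (Fintype.card mm * (2 * (((((L ^ r * L ^ kk : ℕ) : ℝ))⁻¹) ^ 2 * ((Cβ * (ξ ^ (2 + β))⁻¹ * (2 * ((L ^ r : ℕ) : ℝ) * ((((L ^ r * L ^ kk : ℕ) : ℝ))⁻¹)) ^ β + 2 * ((((L ^ r * L ^ kk : ℕ) : ℝ))⁻¹) * ((C / ξ) * (C / ξ ^ 2))) * Real.exp (5 * (((((L ^ r * L ^ kk : ℕ) : ℝ))⁻¹) * (C / ξ))))) + ((((L ^ r * L ^ kk : ℕ) : ℝ))⁻¹) ^ 2 * ((C / ξ ^ 2) * Real.exp (((((L ^ r * L ^ kk : ℕ) : ℝ))⁻¹) * (C / ξ))) * (((d + 1 : ℕ) : ℝ) * (((L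 ^ r - 1 : ℕ) : ℝ) * (((((L ^ r * L ^ kk : ℕ) : ℝ))⁻¹) ^ 2 * ((C / ξ ^ 2) * Real.exp (((((L ^ r * L ^ kk : ℕ) : ℝ))⁻¹) * (C / ξ)))))) + (((((L ^ r * L ^ kk : ℕ) : ℝ))⁻¹) ^ 2 * ((C / ξ ^ 2) * Real.exp (((((L ^ r * L ^ kk : ℕ) : ℝ))⁻¹) * (C / ξ))) + (((d + 1 : ℕ) : ℝ) * (((L ^ r - 1 : ℕ) : ℝ) * (((((L ^ r * L ^ kk : ℕ) : ℝ))⁻¹) ^ 2 * ((C / ξ ^ 2) * Real.exp (((((L ^ r * L ^ kk : ℕ) : ℝ))⁻¹) * (C / ξ)))))) + ((((L ^ r * L ^ kk : ℕ) : ℝ))⁻¹) ^ 2 * ((C / ξ ^ 2) * Real.exp (((((L ^ r * L ^ kk : ℕ) : ℝ))⁻¹) * (C / ξ)))) * (((((L ^ r * L ^ kk : ℕ) : ℝ))⁻¹) ^ 2 * ((C / ξ ^ 2) * Real.exp (((((L ^ r * L ^ kk : ℕ) : ℝ))⁻¹) * (C / ξ)))))) + Fintype.card mm * (2 * ((L ^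 kk : ℕ) : ℝ) ^ 2 * (2 * ((L ^ r : ℕ) : ℝ) ^ 3 * ((((((L ^ r * L ^ kk : ℕ) : ℝ))⁻¹) * ((C / ξ) * Real.exp (((((L ^ r * L ^ kk : ℕ) : ℝ))⁻¹) * (C / ξ)))) * (((((L ^ r * L ^ kk : ℕ) : ℝ))⁻¹) ^ 2 * ((C / ξ ^ 2) * Real.exp (((((L ^ r * L ^ kk : ℕ) : ℝ))⁻¹) * (C / ξ))))) + ((L ^ r : ℕ) : ℝ) ^ 2 * (((((L ^ r * L ^ kk : ℕ) : ℝ))⁻¹) ^ 2 * ((Cβ * (ξ ^ (2 + β))⁻¹ * (2 * ((L ^ r : ℕ) : ℝ) * ((((L ^ r * L ^ kk : ℕ) : ℝ))⁻¹)) ^ β + 2 * ((((L ^ r * L ^ kk : ℕ) : ℝ))⁻¹) * ((C / ξ) * (C / ξ ^ 2))) * Real.exp (5 * (((((L ^ r * L ^ kk : ℕ) : ℝ))⁻¹) * (C / ξ)))))) + 2 * (((L ^ r : ℕ) : ℝ) * ((L ^ kk : ℕ) : ℝ)) ^ 2 * ((((L ^ r : ℕ) : ℝ) + 1) * (((((L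 ^ r * L ^ kk : ℕ) : ℝ))⁻¹) * ((C / ξ) * Real.exp (((((L ^ r * L ^ kk : ℕ) : ℝ))⁻¹) * (C / ξ)))) * (((((L ^ r * L ^ kk : ℕ) : ℝ))⁻¹) ^ 2 * ((C / ξ ^ 2) * Real.exp (((((L ^ r * L ^ kk : ℕ) : ℝ))⁻¹) * (C / ξ)))))))) ≤ oB →
        HasMaj (ScNorm d L mv kk hL ι) (BlockNorm.ofBlocks (unitTorusGeo L kk (cvM d L mv kk hL)) (liftBlk (scBlk d L mv kk hL ∘ kingPr L kk r (cvM d L mv kk hL)) ι))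
          (idef (ctauS (cvM d L mv kk hL) L kk r (fun μ x' => coordMat e (ContinuousLinearMap.mulLeftRight ℝ (Matrix mm mm ℂ) ((U' μ x' : Matrix mm mm ℂ)) ((U' μ x' : Matrix mm mm ℂ))ᴴ))) (ctauS (cvM d L mv kk hL) L kk r (fun μ x' => coordMat e (ContinuousLinearMap.mulLeftRight ℝ (Matrix mm mm ℂ) ((U' μ x' : Matrix mm mm ℂ)) ((U' μ x' : Matrix mm mm ℂ))ᴴ))) (scGreenOp' d L mv kk r hL (aK a₀ (L : ℝ) (r + kk) * (((L ^ r * L ^ kk : ℕ) : ℝ)) ^ (d + 1)) ((((L ^ r * L ^ kk : ℕ) : ℝ))⁻¹) ι e (fun μ z => (U' μ z : Matrix mm mm ℂ))) (scGreenOp d L mv kk hL (aK a₀ (L : ℝ) kk * (((L ^ kk : ℕ) : ℝ)) ^ (d + 1)) ((((L ^ kk : ℕ) : ℝ))⁻¹) ι e (fun μ y => mprod (fun t => (U' μ (kingSec (cvM d L mv kk hL) L kk r y + t • unitVec (fine (L ^ r * L ^ kk) (cvM d L mv kk hL)) μ) : Matrix mm mm ℂ)) (L ^ r))))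
          (fun y y' => D * (((L : ℝ) ^ kk) ^ (-(1 / 4 : ℝ)) + oB) * Real.exp (-(δ / 16 * (unitTorusGeo L kk (cvM d L mv kk hL)).dist y y'))) := by
  obtain ⟨δ, w₀, R₀, D, hδ, hR₀, H⟩ := uN_idef_scGreenOp_of_reg335Holder_letters (d := d) hL hL7 ha₀ ι
  have hLpos : 0 < L := (by have := hL.2; omega)
  have hL1r : (1 : ℝ) < (L : ℝ) := by exact_mod_cast hL.2
  have hL2r : (2 : ℝ) ≤ (L : ℝ) := by exact_mod_cast (show 2 ≤ L by have := hL.2; omega)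
  have hI0 : (0 : ℝ) ≤ (Fintype.card ι : ℝ) := Nat.cast_nonneg _
  have hdd0 : (0 : ℝ) ≤ (d : ℝ) := Nat.cast_nonneg _
  obtain ⟨K₁, hK₁⟩ : ∃ K₁ : ℝ, K₁ = (Fintype.card ι : ℝ) * (6 + ((d : ℝ) + 1) * (36 * (Fintype.card ι : ℝ) + 6)) := ⟨_, rfl⟩
  obtain ⟨K₂, hK₂⟩ : ∃ K₂ : ℝ, K₂ = (1 + 2 * ((d : ℝ) + 1)) + 2 * a₀ * (Fintype.card ι : ℝ) * (4 * ((d : ℝ) + 1) ^ 2 * (Fintype.card ι : ℝ) + 4 * ((d : ℝ) + 1)) := ⟨_, rfl⟩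
  obtain ⟨hK₁0, hK₂0⟩ : 0 ≤ K₁ ∧ 0 ≤ K₂ := ⟨by rw [hK₁]; positivity, by rw [hK₂]; positivity⟩
  obtain ⟨c₀, hc₀⟩ : ∃ c₀ : ℝ, c₀ = min (1 / (100 * ((d : ℝ) + 1) * ((Fintype.card ι : ℝ) + 1) * (K₁ + 1))) (R₀ / (K₁ * K₂ + 1)) := ⟨_, rfl⟩
  have hc₀pos : 0 < c₀ := by rw [hc₀]; exact lt_min (by positivity) (by positivity)
  have hc₀a : c₀ ≤ 1 / (100 * ((d : ℝ) + 1) * ((Fintype.card ι : ℝ) + 1) * (K₁ + 1)) := by rw [hc₀]; exact min_le_left _ _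
  have hc₀b : c₀ ≤ R₀ / (K₁ * K₂ + 1) := by rw [hc₀]; exact min_le_right _ _
  obtain ⟨KI, hKI⟩ : ∃ KI : ℝ, KI = (3 * ((d : ℝ) + 2) + 72 * (Fintype.card ι : ℝ)) * c₀ := ⟨_, rfl⟩
  obtain ⟨Aη, hAη⟩ : ∃ Aη : ℝ, Aη = ((Fintype.card ι : ℝ) * KI + (Fintype.card ι : ℝ) ^ 2 * ((d : ℝ) + 1) * KI) * (1 + 2 * ((d : ℝ) + 1)) +
      2 * a₀ * (Fintype.card ι : ℝ) ^ 2 * (((d : ℝ) + 1) * (3 * (d : ℝ) + 6) * c₀) + 12 * ((d : ℝ) + 1) * (Fintype.card ι : ℝ) * c₀ := ⟨_, rfl⟩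
  obtain ⟨Bc, hBc⟩ : ∃ Bc : ℝ, Bc = 2 * a₀ * (Fintype.card ι : ℝ) * (1 + (Fintype.card ι : ℝ)) := ⟨_, rfl⟩
  obtain ⟨KB, hKB⟩ : ∃ KB : ℝ, KB = (Fintype.card ι : ℝ) * ((d : ℝ) + 1) * (1 + 2 * ((d : ℝ) + 1)) := ⟨_, rfl⟩
  refine ⟨δ, w₀, c₀, max D 0 * (1 + Aη + Bc + KB), hδ, hc₀pos, fun mv kk r hk hr hw₀ => ?_⟩
  intro mm _ _ _ e he U' hU'g Q ξ C β Cβ hξ hC hβ hCβ hsmall h335 hQ oB hoB hBle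
  have H1 := H mv kk r hk hr hw₀ e he U' hU'g Q ξ C β Cβ hξ hC hβ hCβ h335 hQ oB hoB hBle
  clear H
  have hκ := @basisConst_nonneg ι _ (Matrix mm mm ℂ) Matrix.frobeniusNormedAddCommGroup Matrix.frobeniusNormedSpace e
  have hx1 : (1 : ℝ) ≤ (L : ℝ) ^ kk := one_le_pow₀ hL1r.le
  have hLk1 : (1 : ℝ) ≤ (((L ^ kk : ℕ) : ℝ)) := by exact_mod_cast Nat.one_le_pow _ _ hLpos
  have hLr1 : (1 : ℝ) ≤ ((L ^ r : ℕ) : ℝ) := by exact_mod_cast Nat.one_le_pow _ _ hLpos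
  have key := fun (y y' : Tor (cvM d L mv kk hL)) => letters_bookkeeping ((Fintype.card ι : ℝ)) ((d : ℝ)) (((d + 1 : ℕ) : ℝ)) ((Fintype.card (Fin (d + 1)) : ℝ)) ((Fintype.card (Fin (d + 1) ⊕ Fin (d + 1)) : ℝ)) ((((L ^ r * L ^ kk : ℕ) : ℝ))) ((((L ^ kk : ℕ) : ℝ))) (((L ^ r : ℕ) : ℝ)) (((L ^ r - 1 : ℕ) : ℝ)) (((((L ^ r * L ^ kk : ℕ) : ℝ))⁻¹)) (((((L ^ kk : ℕ) : ℝ))⁻¹)) (@basisConst ι _ (Matrix mm mm ℂ) Matrix.frobeniusNormedAddCommGroup Matrix.frobeniusNormedSpace e * (2 * Real.sqrt (Fintype.card mm))) (Real.sqrt (Fintype.card mm)) ((C / ξ)) ((C / ξ ^ 2)) (((C / ξ) * Real.exp (((((L ^ r * L ^ kk : ℕ) : ℝ))⁻¹) * (C / ξ)))) (((C / ξ ^ 2) * Real.exp (((((L ^ r * L ^ kk : ℕ) : ℝ))⁻¹) * (C / ξ)))) (((1 + ((((L ^ r * L ^ kk : ℕ) : ℝ))⁻¹) * ((C / ξ)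 * Real.exp (((((L ^ r * L ^ kk : ℕ) : ℝ))⁻¹) * (C / ξ)))) ^ (L ^ r) - 1)) ((((1 + ((((L ^ r * L ^ kk : ℕ) : ℝ))⁻¹) * ((C / ξ) * Real.exp (((((L ^ r * L ^ kk : ℕ) : ℝ))⁻¹) * (C / ξ)))) ^ (L ^ r) - 1) / ((((L ^ kk : ℕ) : ℝ))⁻¹))) ((((C / ξ ^ 2) * Real.exp (((((L ^ r * L ^ kk : ℕ) : ℝ))⁻¹) * (C / ξ))) * (1 + ((((L ^ r * L ^ kk : ℕ) : ℝ))⁻¹) * ((C / ξ) * Real.exp (((((L ^ r * L ^ kk : ℕ) : ℝ))⁻¹) * (C / ξ)))) ^ (L ^ r))) ((@basisConst ι _ (Matrix mm mm ℂ) Matrix.frobeniusNormedAddCommGroup Matrix.frobeniusNormedSpace e * (2 * Real.sqrt (Fintype.card mm)) * (Real.sqrt (Fintype.card mm) * (((1 + ((((L ^ r * L ^ kk : ℕ) : ℝ))⁻¹) * ((C / ξ) * Real.exp (((((L ^ r * L ^ kk : ℕ) : ℝ))⁻¹) * (C / ξ)))) ^ (L ^ r) - 1) / ((((L ^ kk :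 ℕ) : ℝ))⁻¹))))) ((@basisConst ι _ (Matrix mm mm ℂ) Matrix.frobeniusNormedAddCommGroup Matrix.frobeniusNormedSpace e * (2 * Real.sqrt (Fintype.card mm)) * (Real.sqrt (Fintype.card mm) * (((C / ξ ^ 2) * Real.exp (((((L ^ r * L ^ kk : ℕ) : ℝ))⁻¹) * (C / ξ))) * (1 + ((((L ^ r * L ^ kk : ℕ) : ℝ))⁻¹) * ((C / ξ) * Real.exp (((((L ^ r * L ^ kk : ℕ) : ℝ))⁻¹) * (C / ξ)))) ^ (L ^ r))))) (((1 + ((((L ^ r * L ^ kk : ℕ) : ℝ))⁻¹) * (((1 + ((((L ^ r * L ^ kk : ℕ) : ℝ))⁻¹) * ((C / ξ) * Real.exp (((((L ^ r * L ^ kk : ℕ) : ℝ))⁻¹) * (C / ξ)))) ^ (L ^ r) - 1) / ((((L ^ kk : ℕ) : ℝ))⁻¹))) ^ (L ^ r) - 1)) (((((L ^ kk : ℕ) : ℝ)) * (@basisConst ι _ (Matrix mm mm ℂ) Matrix.frobeniusNormedAddCommGroup Matrix.frobeniusNormedSpace e * (2 * Real.sqrt (Fintype.card mm)) * (Real.sqrt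 (Fintype.card mm) * ((1 + ((((L ^ r * L ^ kk : ℕ) : ℝ))⁻¹) * (((1 + ((((L ^ r * L ^ kk : ℕ) : ℝ))⁻¹) * ((C / ξ) * Real.exp (((((L ^ r * L ^ kk : ℕ) : ℝ))⁻¹) * (C / ξ)))) ^ (L ^ r) - 1) / ((((L ^ kk : ℕ) : ℝ))⁻¹))) ^ (L ^ r) - 1))))) (((1 + Fintype.card ι * (((((L ^ r * L ^ kk : ℕ) : ℝ))⁻¹) * (@basisConst ι _ (Matrix mm mm ℂ) Matrix.frobeniusNormedAddCommGroup Matrix.frobeniusNormedSpace e * (2 * Real.sqrt (Fintype.card mm)) * (Real.sqrt (Fintype.card mm) * (((1 + ((((L ^ r * L ^ kk : ℕ) : ℝ))⁻¹) * ((C / ξ) * Real.exp (((((L ^ r * L ^ kk : ℕ) : ℝ))⁻¹) * (C / ξ)))) ^ (L ^ r) - 1) / ((((L ^ kk : ℕ) : ℝ))⁻¹)))))) ^ (L ^ r) - 1)) (((((d + 1 : ℕ) : ℝ) * ((L ^ r - 1 : ℕ) : ℝ) + (L ^ r : ℕ) + 1))) ((((L ^ r * L ^ kk : ℕ) : ℝ)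 * (@basisConst ι _ (Matrix mm mm ℂ) Matrix.frobeniusNormedAddCommGroup Matrix.frobeniusNormedSpace e * (2 * Real.sqrt (Fintype.card mm)) * (Real.sqrt (Fintype.card mm) * ((((d + 1 : ℕ) : ℝ) * ((L ^ r - 1 : ℕ) : ℝ) + (L ^ r : ℕ) + 1) * (((((L ^ r * L ^ kk : ℕ) : ℝ))⁻¹) ^ 2 * ((C / ξ ^ 2) * Real.exp (((((L ^ r * L ^ kk : ℕ) : ℝ))⁻¹) * (C / ξ)))))) + ((1 + Fintype.card ι * (((((L ^ r * L ^ kk : ℕ) : ℝ))⁻¹) * (@basisConst ι _ (Matrix mm mm ℂ) Matrix.frobeniusNormedAddCommGroup Matrix.frobeniusNormedSpace e * (2 * Real.sqrt (Fintype.card mm)) * (Real.sqrt (Fintype.card mm) * (((1 + ((((L ^ r * L ^ kk : ℕ) : ℝ))⁻¹) * ((C / ξ) * Real.exp (((((L ^ r * L ^ kk : ℕ) : ℝ))⁻¹) * (C / ξ)))) ^ (L ^ r) - 1) / ((((L ^ kk : ℕ) : ℝ))⁻¹)))))) ^ (L ^ r) - 1) * (((((L ^ r * L ^ kk : ℕ)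 : ℝ))⁻¹) * (@basisConst ι _ (Matrix mm mm ℂ) Matrix.frobeniusNormedAddCommGroup Matrix.frobeniusNormedSpace e * (2 * Real.sqrt (Fintype.card mm)) * (Real.sqrt (Fintype.card mm) * (((1 + ((((L ^ r * L ^ kk : ℕ) : ℝ))⁻¹) * ((C / ξ) * Real.exp (((((L ^ r * L ^ kk : ℕ) : ℝ))⁻¹) * (C / ξ)))) ^ (L ^ r) - 1) / ((((L ^ kk : ℕ) : ℝ))⁻¹)))))))) (Fintype.card ι * (((L ^ r * L ^ kk : ℕ) : ℝ) * (@basisConst ι _ (Matrix mm mm ℂ) Matrix.frobeniusNormedAddCommGroup Matrix.frobeniusNormedSpace e * (2 * Real.sqrt (Fintype.card mm)) * (Real.sqrt (Fintype.card mm) * ((((d + 1 : ℕ) : ℝ) * ((L ^ r - 1 : ℕ) : ℝ) + (L ^ r : ℕ) + 1) * (((((L ^ r * L ^ kk : ℕ) : ℝ))⁻¹) ^ 2 * ((C / ξ ^ 2) * Real.exp (((((L ^ r * L ^ kk : ℕ) : ℝ))⁻¹) * (C / ξ)))))) + ((1 + Fintype.card ι * (((((L ^ r * L ^ kk : ℕ)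 : ℝ))⁻¹) * (@basisConst ι _ (Matrix mm mm ℂ) Matrix.frobeniusNormedAddCommGroup Matrix.frobeniusNormedSpace e * (2 * Real.sqrt (Fintype.card mm)) * (Real.sqrt (Fintype.card mm) * (((1 + ((((L ^ r * L ^ kk : ℕ) : ℝ))⁻¹) * ((C / ξ) * Real.exp (((((L ^ r * L ^ kk : ℕ) : ℝ))⁻¹) * (C / ξ)))) ^ (L ^ r) - 1) / ((((L ^ kk : ℕ) : ℝ))⁻¹)))))) ^ (L ^ r) - 1) * (((((L ^ r * L ^ kk : ℕ) : ℝ))⁻¹) * (@basisConst ι _ (Matrix mm mm ℂ) Matrix.frobeniusNormedAddCommGroup Matrix.frobeniusNormedSpace e * (2 * Real.sqrt (Fintype.card mm)) * (Real.sqrt (Fintype.card mm) * (((1 + ((((L ^ r * L ^ kk : ℕ) : ℝ))⁻¹) * ((C / ξ) * Real.exp (((((L ^ r * L ^ kk : ℕ) : ℝ))⁻¹) * (C / ξ)))) ^ (L ^ r) - 1) / ((((L ^ kk : ℕ) : ℝ))⁻¹)))))))) (Fintype.card ι * (Fintype.card (Fin (d + 1)) * (oB + Fintype.card ι * ((((L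 ^ r * L ^ kk : ℕ) : ℝ) * (@basisConst ι _ (Matrix mm mm ℂ) Matrix.frobeniusNormedAddCommGroup Matrix.frobeniusNormedSpace e * (2 * Real.sqrt (Fintype.card mm)) * (Real.sqrt (Fintype.card mm) * ((((d + 1 : ℕ) : ℝ) * ((L ^ r - 1 : ℕ) : ℝ) + (L ^ r : ℕ) + 1) * (((((L ^ r * L ^ kk : ℕ) : ℝ))⁻¹) ^ 2 * ((C / ξ ^ 2) * Real.exp (((((L ^ r * L ^ kk : ℕ) : ℝ))⁻¹) * (C / ξ)))))) + ((1 + Fintype.card ι * (((((L ^ r * L ^ kk : ℕ) : ℝ))⁻¹) * (@basisConst ι _ (Matrix mm mm ℂ) Matrix.frobeniusNormedAddCommGroup Matrix.frobeniusNormedSpace e * (2 * Real.sqrt (Fintype.card mm)) * (Real.sqrt (Fintype.card mm) * (((1 + ((((L ^ r * L ^ kk : ℕ) : ℝ))⁻¹) * ((C / ξ) * Real.exp (((((L ^ r * L ^ kk : ℕ) : ℝ))⁻¹) * (C / ξ)))) ^ (L ^ r) - 1) / ((((L ^ kk : ℕ) : ℝ))⁻¹)))))) ^ (L ^ r) - 1)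 * (((((L ^ r * L ^ kk : ℕ) : ℝ))⁻¹) * (@basisConst ι _ (Matrix mm mm ℂ) Matrix.frobeniusNormedAddCommGroup Matrix.frobeniusNormedSpace e * (2 * Real.sqrt (Fintype.card mm)) * (Real.sqrt (Fintype.card mm) * (((1 + ((((L ^ r * L ^ kk : ℕ) : ℝ))⁻¹) * ((C / ξ) * Real.exp (((((L ^ r * L ^ kk : ℕ) : ℝ))⁻¹) * (C / ξ)))) ^ (L ^ r) - 1) / ((((L ^ kk : ℕ) : ℝ))⁻¹))))))) * ((@basisConst ι _ (Matrix mm mm ℂ) Matrix.frobeniusNormedAddCommGroup Matrix.frobeniusNormedSpace e * (2 * Real.sqrt (Fintype.card mm)) * (Real.sqrt (Fintype.card mm) * (((1 + ((((L ^ r * L ^ kk : ℕ) : ℝ))⁻¹) * ((C / ξ) * Real.exp (((((L ^ r * L ^ kk : ℕ) : ℝ))⁻¹) * (C / ξ)))) ^ (L ^ r) - 1) / ((((L ^ kk : ℕ) : ℝ))⁻¹)))) + (((L ^ kk : ℕ) : ℝ) * (@basisConst ι _ (Matrix mm mm ℂ) Matrix.frobeniusNormedAddCommGroup Matrix.frobeniusNormedSpace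 e * (2 * Real.sqrt (Fintype.card mm)) * (Real.sqrt (Fintype.card mm) * ((1 + ((((L ^ r * L ^ kk : ℕ) : ℝ))⁻¹) * (((1 + ((((L ^ r * L ^ kk : ℕ) : ℝ))⁻¹) * ((C / ξ) * Real.exp (((((L ^ r * L ^ kk : ℕ) : ℝ))⁻¹) * (C / ξ)))) ^ (L ^ r) - 1) / ((((L ^ kk : ℕ) : ℝ))⁻¹))) ^ (L ^ r) - 1))))))))) ((@basisConst ι _ (Matrix mm mm ℂ) Matrix.frobeniusNormedAddCommGroup Matrix.frobeniusNormedSpace e * (2 * Real.sqrt (Fintype.card mm)) * (Real.sqrt (Fintype.card mm) * ((d + 1) * (d * ((((L ^ r * L ^ kk : ℕ) : ℝ)) * (((L ^ r : ℕ) : ℝ) * (((((L ^ r * L ^ kk : ℕ) : ℝ))⁻¹) ^ 2 * ((C / ξ ^ 2) * Real.exp (((((L ^ r * L ^ kk : ℕ) : ℝ))⁻¹) * (C / ξ)))))) + ((1 + (((((L ^ r * L ^ kk : ℕ) : ℝ))⁻¹) * ((C / ξ) * Real.exp (((((L ^ r * L ^ kk : ℕ) : ℝ))⁻¹) * (C /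 ξ))))) ^ (L ^ r) - 1)))))) ((aK a₀ (L : ℝ) kk)) ((aK a₀ (L : ℝ) (r + kk))) ((Fintype.card ι * (|aK a₀ (L : ℝ) (r + kk) - aK a₀ (L : ℝ) kk| * (1 + Fintype.card ι) + |aK a₀ (L : ℝ) kk| * (2 * Fintype.card ι * (@basisConst ι _ (Matrix mm mm ℂ) Matrix.frobeniusNormedAddCommGroup Matrix.frobeniusNormedSpace e * (2 * Real.sqrt (Fintype.card mm)) * (Real.sqrt (Fintype.card mm) * ((d + 1) * (d * ((((L ^ r * L ^ kk : ℕ) : ℝ)) * (((L ^ r : ℕ) : ℝ) * (((((L ^ r * L ^ kk : ℕ) : ℝ))⁻¹) ^ 2 * ((C / ξ ^ 2) * Real.exp (((((L ^ r * L ^ kk : ℕ) : ℝ))⁻¹) * (C / ξ)))))) + ((1 + (((((L ^ r * L ^ kk : ℕ) : ℝ))⁻¹) * ((C / ξ) * Real.exp (((((L ^ r * L ^ kk : ℕ) : ℝ))⁻¹) * (C / ξ))))) ^ (L ^ r) - 1))))))))) ((Fintype.card ι * (@basisConst ι _ (Matrix mm mm ℂ) Matrix.frobeniusNormedAddCommGroup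 Matrix.frobeniusNormedSpace e * (2 * Real.sqrt (Fintype.card mm)) * (Real.sqrt (Fintype.card mm) * (((1 + ((((L ^ r * L ^ kk : ℕ) : ℝ))⁻¹) * ((C / ξ) * Real.exp (((((L ^ r * L ^ kk : ℕ) : ℝ))⁻¹) * (C / ξ)))) ^ (L ^ r) - 1) / ((((L ^ kk : ℕ) : ℝ))⁻¹)))) + Fintype.card ι * (Fintype.card (Fin (d + 1)) * (Fintype.card ι * (@basisConst ι _ (Matrix mm mm ℂ) Matrix.frobeniusNormedAddCommGroup Matrix.frobeniusNormedSpace e * (2 * Real.sqrt (Fintype.card mm)) * (Real.sqrt (Fintype.card mm) * (((1 + ((((L ^ r * L ^ kk : ℕ) : ℝ))⁻¹) * ((C / ξ) * Real.exp (((((L ^ r * L ^ kk : ℕ) : ℝ))⁻¹) * (C / ξ)))) ^ (L ^ r) - 1) / ((((L ^ kk : ℕ) : ℝ))⁻¹)))) ^ 2 + (@basisConst ι _ (Matrix mm mm ℂ) Matrix.frobeniusNormedAddCommGroup Matrix.frobeniusNormedSpace e * (2 * Real.sqrt (Fintype.card mm)) * (Real.sqrt (Fintype.card mm) * (((C / ξ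 ^ 2) * Real.exp (((((L ^ r * L ^ kk : ℕ) : ℝ))⁻¹) * (C / ξ))) * (1 + ((((L ^ r * L ^ kk : ℕ) : ℝ))⁻¹) * ((C / ξ) * Real.exp (((((L ^ r * L ^ kk : ℕ) : ℝ))⁻¹) * (C / ξ)))) ^ (L ^ r)))))))) (((1 + (Fintype.card ι * (@basisConst ι _ (Matrix mm mm ℂ) Matrix.frobeniusNormedAddCommGroup Matrix.frobeniusNormedSpace e * (2 * Real.sqrt (Fintype.card mm)) * (Real.sqrt (Fintype.card mm) * (((1 + ((((L ^ r * L ^ kk : ℕ) : ℝ))⁻¹) * ((C / ξ) * Real.exp (((((L ^ r * L ^ kk : ℕ) : ℝ))⁻¹) * (C / ξ)))) ^ (L ^ r) - 1) / ((((L ^ kk : ℕ) : ℝ))⁻¹)))) + Fintype.card ι * (Fintype.card (Fin (d + 1)) * (Fintype.card ι * (@basisConst ι _ (Matrix mm mm ℂ) Matrix.frobeniusNormedAddCommGroup Matrix.frobeniusNormedSpace e * (2 * Real.sqrt (Fintype.card mm)) * (Real.sqrt (Fintype.card mm) * (((1 + ((((L ^ r * L ^ kk : ℕ) : ℝ))⁻¹)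 * ((C / ξ) * Real.exp (((((L ^ r * L ^ kk : ℕ) : ℝ))⁻¹) * (C / ξ)))) ^ (L ^ r) - 1) / ((((L ^ kk : ℕ) : ℝ))⁻¹)))) ^ 2 + (@basisConst ι _ (Matrix mm mm ℂ) Matrix.frobeniusNormedAddCommGroup Matrix.frobeniusNormedSpace e * (2 * Real.sqrt (Fintype.card mm)) * (Real.sqrt (Fintype.card mm) * (((C / ξ ^ 2) * Real.exp (((((L ^ r * L ^ kk : ℕ) : ℝ))⁻¹) * (C / ξ))) * (1 + ((((L ^ r * L ^ kk : ℕ) : ℝ))⁻¹) * ((C / ξ) * Real.exp (((((L ^ r * L ^ kk : ℕ) : ℝ))⁻¹) * (C / ξ)))) ^ (L ^ r))))))) * ((((L ^ kk : ℕ) : ℝ))⁻¹)) ^ ((d + 1) * L ^ kk) - 1)) (((1 + (Fintype.card ι * (@basisConst ι _ (Matrix mm mm ℂ) Matrix.frobeniusNormedAddCommGroup Matrix.frobeniusNormedSpace e * (2 * Real.sqrt (Fintype.card mm)) * (Real.sqrt (Fintype.card mm) * (((1 + ((((L ^ r * L ^ kk : ℕ) : ℝ))⁻¹) * ((C / ξ)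 * Real.exp (((((L ^ r * L ^ kk : ℕ) : ℝ))⁻¹) * (C / ξ)))) ^ (L ^ r) - 1) / ((((L ^ kk : ℕ) : ℝ))⁻¹)))) + Fintype.card ι * (Fintype.card (Fin (d + 1)) * (Fintype.card ι * (@basisConst ι _ (Matrix mm mm ℂ) Matrix.frobeniusNormedAddCommGroup Matrix.frobeniusNormedSpace e * (2 * Real.sqrt (Fintype.card mm)) * (Real.sqrt (Fintype.card mm) * (((1 + ((((L ^ r * L ^ kk : ℕ) : ℝ))⁻¹) * ((C / ξ) * Real.exp (((((L ^ r * L ^ kk : ℕ) : ℝ))⁻¹) * (C / ξ)))) ^ (L ^ r) - 1) / ((((L ^ kk : ℕ) : ℝ))⁻¹)))) ^ 2 + (@basisConst ι _ (Matrix mm mm ℂ) Matrix.frobeniusNormedAddCommGroup Matrix.frobeniusNormedSpace e * (2 * Real.sqrt (Fintype.card mm)) * (Real.sqrt (Fintype.card mm) * (((C / ξ ^ 2) * Real.exp (((((L ^ r * L ^ kk : ℕ) : ℝ))⁻¹) * (C / ξ))) * (1 + ((((L ^ r * L ^ kk : ℕ) : ℝ))⁻¹) * ((C / ξ) * Real.exp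 (((((L ^ r * L ^ kk : ℕ) : ℝ))⁻¹) * (C / ξ)))) ^ (L ^ r))))))) * ((((L ^ r * L ^ kk : ℕ) : ℝ))⁻¹)) ^ ((d + 1) * (L ^ r * L ^ kk)) - 1)) (((1 + (Fintype.card ι * (((((L ^ r * L ^ kk : ℕ) : ℝ))⁻¹) * (@basisConst ι _ (Matrix mm mm ℂ) Matrix.frobeniusNormedAddCommGroup Matrix.frobeniusNormedSpace e * (2 * Real.sqrt (Fintype.card mm)) * (Real.sqrt (Fintype.card mm) * (((1 + ((((L ^ r * L ^ kk : ℕ) : ℝ))⁻¹) * ((C / ξ) * Real.exp (((((L ^ r * L ^ kk : ℕ) : ℝ))⁻¹) * (C / ξ)))) ^ (L ^ r) - 1) / ((((L ^ kk : ℕ) : ℝ))⁻¹))))))) ^ ((d + 1) * (L ^ r - 1)) - 1)) ((((L : ℝ) ^ kk) ^ (-(1 / 4 : ℝ)))) ((((L : ℝ) ^ (2 * kk))⁻¹)) oB a₀ R₀ K₁ K₂ c₀ KI Aη Bc KB D (Real.exp (-(δ / 16 * (unitTorusGeo L kk (cvM d L mv kk hL)).dist y y')))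
    (L ^ r) ((d + 1) * L ^ kk) ((d + 1) * (L ^ r * L ^ kk)) ((d + 1) * (L ^ r - 1))
    hI0 hdd0 (by push_cast; ring) (by simp) (by simp [Fintype.card_sum]; ring) ha₀ hK₁ hK₂ hc₀pos hc₀a hc₀b hKI hAη hBc hKB
    hLk1 hLr1 (by rw [Nat.cast_mul]) (by rw [Nat.cast_sub (Nat.one_le_pow _ _ hLpos), Nat.cast_one]) rfl rfl
    rfl (by push_cast; ring) (by push_cast; ring) (by rw [Nat.cast_mul, Nat.cast_sub (Nat.one_le_pow _ _ hLpos)]; push_cast; ring)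
    (by positivity) (Real.sqrt_nonneg _) (by positivity) (by positivity) hsmall rfl rfl rfl rfl rfl rfl rfl rfl rfl rfl rfl rfl rfl rfl rfl
    (by rw [abs_of_pos (aK_pos ha₀ hL1r hk)]; exact aK_le ha₀ hL1r hk) (abs_aK_sub_aK_le ha₀ hL2r hk r) rfl rfl rfl rfl rfl (by positivity)
    (by rw [Nat.cast_pow]; exact (inv_le_rpow_neg_quarter hx1).1) (by rw [mul_comm, pow_mul]; exact (inv_le_rpow_neg_quarter hx1).2) hoB (Real.exp_pos _)
  have hmain := H1 (key (0 : Tor (cvM d L mv kk hL)) 0).1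
  exact hmain.mono fun y y' => (key y y').2

set_option maxHeartbeats 800000 in
/-- ★★★ `uN_idef_scGreenOp_of_reg335Holder_small` at `o_B := o_B^{H,expl}` (n15-c∕373's `_explicit` for the named Green's functions). [cite: Balaban1985BackgroundPropagators, (3.35) p.396, (3.51)–(3.52) p.400 (shapes); King1986, p.664 (pairing)] -/
theorem uN_idef_scGreenOp_of_reg335Holder_small_explicit (hL : Odd L ∧ 1 < L) (hL7 : 7 ≤ L) {a₀ : ℝ} (ha₀ : 0 < a₀) (ι : Type) [Fintype ι] [DecidableEq ι] :
    ∃ δ w₀ c₀ D : ℝ, 0 < δ ∧ 0 < c₀ ∧ ∀ (mv kk r : ℕ), 1 ≤ kk → 1 ≤ r → w₀ ≤ ((L ^ mv : ℕ) : ℝ) →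
      ∀ {mm : Type} [Fintype mm] [DecidableEq mm] [Nonempty mm] (e : Matrix mm mm ℂ ≃L[ℝ] (ι → ℝ)), (∀ A B : Matrix mm mm ℂ, traceForm A B = e A ⬝ᵥ e B) →
      ∀ (U' : Fin (d + 1) → ScX' d L mv kk r hL → (Matrix mm mm ℂ)ˣ), (∀ μ x', (U' μ x' : Matrix mm mm ℂ) ∈ Matrix.unitaryGroup mm ℂ) →
      ∀ (Q : (Fin (d + 1) → ZMod (2 * L)) → Set (ScX' d L mv kk r hL)) (ξ C β Cβ : ℝ), 0 < ξ → 0 ≤ C → 0 ≤ β → 0 ≤ Cβ →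
        (1 + @basisConst ι _ (Matrix mm mm ℂ) Matrix.frobeniusNormedAddCommGroup Matrix.frobeniusNormedSpace e * (2 * Real.sqrt (Fintype.card mm)) * Real.sqrt (Fintype.card mm)) ^ 2 * (C / ξ + C / ξ ^ 2) ≤ c₀ →
        (∀ k, Reg335HolderCube (scShift' d L mv kk r hL) U' ((((L ^ r * L ^ kk : ℕ) : ℝ))⁻¹) (Q k) ξ (fun z z' => ((((L ^ r * L ^ kk : ℕ) : ℝ))⁻¹) * tdistT (fine (L ^ r * L ^ kk) (cvM d L mv kk hL)) z z') C β Cβ) →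
        (∀ k z, (∃ y ∈ cvSk d L mv kk hL k, (unitTorusGeo L kk (cvM d L mv kk hL)).dist (scBlk' d L mv kk r hL z) y ≤ 5) → z ∈ Q k) →
        HasMaj (ScNorm d L mv kk hL ι) (BlockNorm.ofBlocks (unitTorusGeo L kk (cvM d L mv kk hL)) (liftBlk (scBlk d L mv kk hL ∘ kingPr L kk r (cvM d L mv kk hL)) ι))
          (idef (ctauS (cvM d L mv kk hL) L kk r (fun μ x' => coordMat e (ContinuousLinearMap.mulLeftRight ℝ (Matrix mm mm ℂ) ((U' μ x' : Matrix mm mm ℂ)) ((U' μ x' : Matrix mm mm ℂ))ᴴ))) (ctauS (cvM d L mv kk hL) L kk r (fun μ x' => coordMat e (ContinuousLinearMap.mulLeftRight ℝ (Matrix mm mm ℂ) ((U' μ x' : Matrix mm mm ℂ)) ((U' μ x' : Matrix mm mm ℂ))ᴴ))) (scGreenOp' d L mv kk r hL (aK a₀ (L : ℝ) (r + kk) * (((L ^ r * L ^ kk : ℕ) : ℝ)) ^ (d + 1)) ((((L ^ r * L ^ kk : ℕ) : ℝ))⁻¹) ι e (fun μ z => (U' μ z : Matrix mm mm ℂ)))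 (scGreenOp d L mv kk hL (aK a₀ (L : ℝ) kk * (((L ^ kk : ℕ) : ℝ)) ^ (d + 1)) ((((L ^ kk : ℕ) : ℝ))⁻¹) ι e (fun μ y => mprod (fun t => (U' μ (kingSec (cvM d L mv kk hL) L kk r y + t • unitVec (fine (L ^ r * L ^ kk) (cvM d L mv kk hL)) μ) : Matrix mm mm ℂ)) (L ^ r))))
          (fun y y' => D * (((L : ℝ) ^ kk) ^ (-(1 / 4 : ℝ)) + (@basisConst ι _ (Matrix mm mm ℂ) Matrix.frobeniusNormedAddCommGroup Matrix.frobeniusNormedSpace e * (((L ^ r * L ^ kk : ℕ) : ℝ) ^ 2 * (Fintype.card mm * (2 * (((((L ^ r * L ^ kk : ℕ) : ℝ))⁻¹) ^ 2 * ((Cβ * (ξ ^ (2 + β))⁻¹ * (2 * ((L ^ r : ℕ) : ℝ) * ((((L ^ r * L ^ kk : ℕ) : ℝ))⁻¹)) ^ β + 2 * ((((L ^ r * L ^ kk : ℕ) : ℝ))⁻¹) * ((C / ξ) * (C / ξ ^ 2))) * Real.exp (5 * (((((L ^ r * L ^ kk : ℕ) : ℝ))⁻¹) * (C / ξ)))))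 + ((((L ^ r * L ^ kk : ℕ) : ℝ))⁻¹) ^ 2 * ((C / ξ ^ 2) * Real.exp (((((L ^ r * L ^ kk : ℕ) : ℝ))⁻¹) * (C / ξ))) * (((d + 1 : ℕ) : ℝ) * (((L ^ r - 1 : ℕ) : ℝ) * (((((L ^ r * L ^ kk : ℕ) : ℝ))⁻¹) ^ 2 * ((C / ξ ^ 2) * Real.exp (((((L ^ r * L ^ kk : ℕ) : ℝ))⁻¹) * (C / ξ)))))) + (((((L ^ r * L ^ kk : ℕ) : ℝ))⁻¹) ^ 2 * ((C / ξ ^ 2) * Real.exp (((((L ^ r * L ^ kk : ℕ) : ℝ))⁻¹) * (C / ξ))) + (((d + 1 : ℕ) : ℝ) * (((L ^ r - 1 : ℕ) : ℝ) * (((((L ^ r * L ^ kk : ℕ) : ℝ))⁻¹) ^ 2 * ((C / ξ ^ 2) * Real.exp (((((L ^ r * L ^ kk : ℕ) : ℝ))⁻¹) * (C / ξ)))))) + ((((L ^ r * L ^ kk : ℕ) : ℝ))⁻¹) ^ 2 * ((C / ξ ^ 2) * Real.exp (((((L ^ r * L ^ kk : ℕ) : ℝ))⁻¹) * (C / ξ))))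 * (((((L ^ r * L ^ kk : ℕ) : ℝ))⁻¹) ^ 2 * ((C / ξ ^ 2) * Real.exp (((((L ^ r * L ^ kk : ℕ) : ℝ))⁻¹) * (C / ξ)))))) + Fintype.card mm * (2 * ((L ^ kk : ℕ) : ℝ) ^ 2 * (2 * ((L ^ r : ℕ) : ℝ) ^ 3 * ((((((L ^ r * L ^ kk : ℕ) : ℝ))⁻¹) * ((C / ξ) * Real.exp (((((L ^ r * L ^ kk : ℕ) : ℝ))⁻¹) * (C / ξ)))) * (((((L ^ r * L ^ kk : ℕ) : ℝ))⁻¹) ^ 2 * ((C / ξ ^ 2) * Real.exp (((((L ^ r * L ^ kk : ℕ) : ℝ))⁻¹) * (C / ξ))))) + ((L ^ r : ℕ) : ℝ) ^ 2 * (((((L ^ r * L ^ kk : ℕ) : ℝ))⁻¹) ^ 2 * ((Cβ * (ξ ^ (2 + β))⁻¹ * (2 * ((L ^ r : ℕ) : ℝ) * ((((L ^ r * L ^ kk : ℕ) : ℝ))⁻¹)) ^ β + 2 * ((((L ^ r * L ^ kk : ℕ) : ℝ))⁻¹) * ((C / ξ) * (C / ξ ^ 2))) * Real.exp (5 * (((((L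 ^ r * L ^ kk : ℕ) : ℝ))⁻¹) * (C / ξ)))))) + 2 * (((L ^ r : ℕ) : ℝ) * ((L ^ kk : ℕ) : ℝ)) ^ 2 * ((((L ^ r : ℕ) : ℝ) + 1) * (((((L ^ r * L ^ kk : ℕ) : ℝ))⁻¹) * ((C / ξ) * Real.exp (((((L ^ r * L ^ kk : ℕ) : ℝ))⁻¹) * (C / ξ)))) * (((((L ^ r * L ^ kk : ℕ) : ℝ))⁻¹) ^ 2 * ((C / ξ ^ 2) * Real.exp (((((L ^ r * L ^ kk : ℕ) : ℝ))⁻¹) * (C / ξ))))))))) * Real.exp (-(δ / 16 * (unitTorusGeo L kk (cvM d L mv kk hL)).dist y y'))) := by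
  obtain ⟨δ, w₀, c₀, D, hδ, hc₀, H⟩ := uN_idef_scGreenOp_of_reg335Holder_small (d := d) hL hL7 ha₀ ι
  refine ⟨δ, w₀, c₀, D, hδ, hc₀, fun mv kk r hk hr hw₀ => ?_⟩
  intro mm _ _ _ e he U' hU'g Q ξ C β Cβ hξ hC hβ hCβ hsmall h335 hQ
  have hκ := @basisConst_nonneg ι _ (Matrix mm mm ℂ) Matrix.frobeniusNormedAddCommGroup Matrix.frobeniusNormedSpace e
  exact H mv kk r hk hr hw₀ e he U' hU'g Q ξ C β Cβ hξ hC hβ hCβ hsmall h335 hQ _ (by positivity) le_rfl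

end Small

end Summit.QuantumFields.YangMills.BalabanUVNodes.N15.Gluing

end
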